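import Literature.AlgebraicGeometry.AbelianSchemes.PDivisibleGroupRingAction              -- ★ DEAL 3 p846327: `isRingActionBT_pDivisibleGroupMap`
import Literature.AlgebraicGeometry.GroupSchemes.BTGroupRingActionCompletion              -- ★ `homOfCompatibleFamily`, `_idem`
import Literature.AlgebraicGeometry.GroupSchemes.BarsottiTateGroupFixedPartCotangent      -- ★ DEAL 1 p846312: `finrank_cotangent_fixLayer_eq`
import Literature.AlgebraicGeometry.GroupSchemes.IsIsoOrEtaleOfNatCard                   -- ★ `hom_finrank_eq_finrank_alg`
import Literature.AlgebraicGeometry.GroupSchemes.UnitAugmentationIdealStalk               -- ★ p846428: `ΓSpecIso_unit_appTop_algebraMap`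
import Literature.AlgebraicGeometry.Motives.AbelianVarietyTorsionCotangent                -- ★ DEAL 2 p846488: `finrank_range_mapCotangent_torsionMap_eq`
import Literature.RingTheory.DedekindDomain.BlockIdempotentFamily                        -- ★ (O-CRT) p846342: `sub_mem_span_pow`, `mul_self_sub_mem_span_pow`
import HarnessLib

/-!
# The `w`-block of `A[p^∞]` is one-dimensional iff the Lie signature of `e_w` is one: `htan`∕`hdim` of `Fix ε_w` from `dim range(a_n^* | 𝔪_e∕𝔪_e²)`

Topic `Literature/AlgebraicGeometry/AbelianSchemes`; namespace `Literature.AlgebraicGeometry.AbelianSchemes`.  THEOREMS ONLY (no definition, no named fact,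
no instance, no notation, no `sorry`).  Cell `hodgecm-mathlib` (D-0151), P6 «MOD programme», K∕BT cut v2.3 §1 bullet «kit tokens for `Bw` — DEAL 1 ▸ DEAL 2 (E) ▸
`hsig n`; layer 0 trivial» as ONE theorem (B-p12 (g32) offer 19:30Z): the unit cotangent ranks `htan`∕`hdim` of the `w`-block `Bw := Fix ε_w` of `A[p^∞]`
(binders VERBATIM those of the (O-DOCK) package ★ `PDivisibleGroupBlockDocking` §Block, B-p17 (g27)) in terms of the Lie signature of the block idempotent
family `a_n ∈ O`, `a_n → e_w`, acting on `𝔪_{A,e} ∕ 𝔪_{A,e}²`.  HC_CM is proved only modulo the printed citations (2 remaining named inputs hLiu418, h413)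
until rung 0 closes; count-neutral.

THE PRINT.  [Tate1967] §2 (2.1)–(2.2): layers of a `p`-divisible group, the dimension read on the tangent space of the layers; [RapoportSmithlingZhang2020Diagonal]
§4.1 (p. 17) and [Liu2021] p. 136: at a place `w` of the reflex∕CM field the `w`-component of `A[p^∞]` cut out by the idempotent `e_w ∈ O_F ⊗ ℤ_p` is a
ONE-DIMENSIONAL `O_{F,w}`-module (Kottwitz signature `(1, n−1)` at `w`).  In the tree's currency: with `εw := β(a)` (`β r := (act.i r)[p^∞]`, ★ DEAL 3;
`a` a block idempotent family, ★ (O-CRT)) and `Bw := Fix εw` (★ `fixBTGroup`, rank function `hrank` = socket (S-H)), the kit tokens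
`htan : ∀ n, dim_k I_e(Bw_n)∕I_e² ≤ 1` and `hdim : dim_k I_e(Bw_1)∕I_e² ≠ 0` (tree `Lines/F0_P6b_BlockNumerics.lean` :220–:223) follow from
`hsig : ∀ n ≥ 1, dim_k range((act.i (a n))^* on 𝔪_{A,e}∕𝔪_{A,e}²) = 1` (socket (S-T), GEN's Kottwitz count): for `n ≥ 1`, ★ DEAL 1
`finrank_cotangent_fixLayer_eq` (`dim I_e(Bw_n)∕I_e² = dim range((εw)_n^*)`, a retract) then `(εw)_n = torsionMap (act.i (a n)) (pⁿ)` (definitional) and ★ DEAL 2 (E)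
`finrank_range_mapCotangent_torsionMap_eq` (`pⁿ = 0` in `k`); for `n = 0` the layer has rank `p⁰ = 1`, so `Γ = k` and `I_e = 0`.

WHAT IS HERE: `finrank_cotangent_unitAugIdeal_eq_zero_of_finrank_alg_eq_one` (rank-one layers have zero unit cotangent space);
**`finrank_cotangent_blockLayer_eq_finrank_range_cotangentMap`** (`n ≥ 1`: `dim I_e(Bw_n)∕I_e² = dim range((act.i (a n))^*)`); `finrank_cotangent_blockLayer_zero`;
HEAD **`htan_hdim_block_of_lieSignature`** (the pair `htan ∧ hdim` for `Bw`, kit :220–:223 verbatim at `B := Bw`).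

## References
* [Tate1967] J. T. Tate, *p-divisible groups*, Proc. Conf. Local Fields (Driebergen, 1966), Springer (1967) — §2 (2.1)–(2.2).
* [RapoportSmithlingZhang2020Diagonal] M. Rapoport, B. Smithling, W. Zhang, *Arithmetic diagonal cycles on unitary Shimura varieties*, Compositio Math. 156 (2020) — §4.1 (p. 17).
* [GortzWedhorn2020] U. Görtz, T. Wedhorn, *Algebraic Geometry I* (2nd ed., 2020) — (6.4) Definition 6.2.
-/

set_option autoImplicit false

noncomputable section

universe u v

open CategoryTheory CategoryTheory.Limits AlgebraicGeometry MonoidalCategory CartesianMonoidalCategory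
open scoped MonObj

namespace Literature.AlgebraicGeometry.AbelianSchemes

open AbelianSchemeOver AbelianSchemeOver.RingAction Literature.AlgebraicGeometry.GroupSchemes Literature.AlgebraicGeometry.GroupSchemes.AffineGroupScheme
open Literature.AlgebraicGeometry.Motives Literature.RingTheory.DedekindDomain

/-! ## §1 A rank-one layer has zero unit cotangent space -/

section RankOne

variable {k : Type u} [Field k]

/-- **A finite `k`-group scheme of rank `1` has `I_e ∕ I_e² = 0`**: `dim_k Γ(X) = 1` and the augmentation `Γ(X) → k` is surjective, so `I_e = 0`
(as in ★ `BTGroup.pos_height_and_finrank_cotangent_le_of_unitComponent`, height-`0` branch). [cite: Tate1967, §2 (2.2)] [cite: GortzWedhorn2020, (6.4) Definition 6.2] -/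
theorem finrank_cotangent_unitAugIdeal_eq_zero_of_finrank_alg_eq_one (X : Over (Spec (.of k))) [GrpObj X]
    (hrk : Module.finrank k (Alg X) = 1) :
    Module.finrank k (RingHom.ker ((η[X] : 𝟙_ (Over (Spec (.of k))) ⟶ X).left.appTop.hom) : Ideal (Alg X)).Cotangent = 0 := by
  haveI : Module.Finite k (Alg X) := Module.finite_of_finrank_eq_succ hrk
  -- the augmentation `ε₀ = ΓSpecIso ∘ Γ(η)` as a `k`-algebra map; it is surjective, so its kernel `I_e` has dimension `1 - 1 = 0`
  let e₀ : Alg X →+* k := (Scheme.ΓSpecIso (.of k)).hom.hom.comp ((η[X] : 𝟙_ (Over (Spec (.of k))) ⟶ X).left.appTop.hom)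
  let ε₀ : Alg X →ₐ[k] k := { toRingHom := e₀, commutes' := fun c => ΓSpecIso_unit_appTop_algebraMap X c }
  have hker : RingHom.ker ε₀.toRingHom = (RingHom.ker ((η[X] : 𝟙_ (Over (Spec (.of k))) ⟶ X).left.appTop.hom) : Ideal (Alg X)) :=
    RingHom.ker_comp_of_injective _ (Scheme.ΓSpecIso (.of k)).commRingCatIsoToRingEquiv.injective
  rw [← hker]
  have hsurjε : Function.Surjective ε₀.toLinearMap := fun r => ⟨algebraMap k _ r, ε₀.commutes r⟩
  have hdimker : Module.finrank k (LinearMap.ker ε₀.toLinearMap) = 0 := by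
    have h := LinearMap.finrank_range_add_finrank_ker ε₀.toLinearMap
    rw [LinearMap.range_eq_top.mpr hsurjε, finrank_top, Module.finrank_self, hrk] at h
    omega
  have hbot : RingHom.ker ε₀.toRingHom = ⊥ := by
    have h1 : LinearMap.ker ε₀.toLinearMap = ⊥ := Submodule.finrank_eq_zero.mp hdimker
    ext x
    simp only [RingHom.mem_ker, AlgHom.toRingHom_eq_coe, AlgHom.coe_toRingHom, Ideal.mem_bot]
    constructor
    · intro hx0
      have hx' : x ∈ LinearMap.ker ε₀.toLinearMap := hx0
      rw [h1] at hx'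
      exact hx'
    · intro hx0
      rw [hx0, map_zero]
  rw [hbot]
  haveI : Subsingleton (⊥ : Ideal (Alg X)).Cotangent :=
    (Ideal.cotangent_subsingleton_iff _).mpr (by rw [IsIdempotentElem, Ideal.bot_mul])
  exact Module.finrank_zero_of_subsingleton

end RankOne

/-! ## §2 The `w`-block `Bw := Fix ε_w`: unit cotangent ranks of the layers from the Lie signature of `a_n` -/

section Block

variable {k : Type u} [Field k] {p : ℕ} {A : AbelianSchemeOver (Spec (.of k))} [IsCommMonObj A.X] {g : ℕ} (hp : p ≠ 0)
  (hg : A.IsOfRelDim g) {O : Type v} [CommRing O] (act : RingAction O A)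
  (w : Ideal O) {e : ℕ} {𝔟 : Ideal O} (hx : Ideal.span {(p : O)} = w ^ e * 𝔟) (hcop : w ⊔ 𝔟 = ⊤)
  (a : ℕ → O) (ha1 : ∀ n, a n - 1 ∈ w ^ (e * n)) (ha2 : ∀ n, a n ∈ 𝔟 ^ n) (h₁ : ℕ)
  (hrank : ∀ n (s : Spec (.of k)),
    (((isRingActionBT_pDivisibleGroupMap act hp hg).homOfCompatibleFamily a
      (sub_mem_span_pow hx hcop ha1 ha2)).fixLayer n).hom.finrank s = p ^ (n * h₁))

/-- **LAYER `n ≥ 1`: `dim_k I_e(Bw_n)∕I_e² = dim_k range((act.i (a n))^* | 𝔪_{A,e}∕𝔪_{A,e}²)`** when `p = 0` in `k` — ★ DEAL 1 (retract) then ★ DEAL 2 (E)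
(`(ε_w)_n = (act.i (a n))[pⁿ]` definitionally, `pⁿ = 0` in `k`). [cite: Tate1967, §2 (2.1)–(2.2)] [cite: RapoportSmithlingZhang2020Diagonal, §4.1 (p. 17)] -/
theorem finrank_cotangent_blockLayer_eq_finrank_range_cotangentMap [hpp : Fact p.Prime] [CharP k p] (n : ℕ) (hn : 0 < n) :
    letI := (((isRingActionBT_pDivisibleGroupMap act hp hg).homOfCompatibleFamily a (sub_mem_span_pow hx hcop ha1 ha2)).fixBTGroup
      ((isRingActionBT_pDivisibleGroupMap act hp hg).homOfCompatibleFamily_idem a (sub_mem_span_pow hx hcop ha1 ha2)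
        (mul_self_sub_mem_span_pow hx hcop ha1 ha2)) h₁ hrank).grpObj n;
    Module.finrank k (RingHom.ker ((η[(((isRingActionBT_pDivisibleGroupMap act hp hg).homOfCompatibleFamily a
        (sub_mem_span_pow hx hcop ha1 ha2)).fixBTGroup ((isRingActionBT_pDivisibleGroupMap act hp hg).homOfCompatibleFamily_idem a
        (sub_mem_span_pow hx hcop ha1 ha2) (mul_self_sub_mem_span_pow hx hcop ha1 ha2)) h₁ hrank).G n] : 𝟙_ (Over (Spec (.of k))) ⟶ _).left.appTop.hom) :
        Ideal (Alg ((((isRingActionBT_pDivisibleGroupMap act hp hg).homOfCompatibleFamily a (sub_mem_span_pow hx hcop ha1 ha2)).fixBTGroup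
          ((isRingActionBT_pDivisibleGroupMap act hp hg).homOfCompatibleFamily_idem a (sub_mem_span_pow hx hcop ha1 ha2)
            (mul_self_sub_mem_span_pow hx hcop ha1 ha2)) h₁ hrank).G n))).Cotangent =
      haveI := act.isMonHom_i (a n)
      Module.finrank k (LinearMap.range (AbelianVariety.cotangentMap A.toAffine.toAbelianVariety
        (InducedCategory.homMk (Grp.ofHom (A := A.X) (B := A.X) (act.i (a n)))))) := by
  haveI := act.isMonHom_i (a n)
  have h1 := ((isRingActionBT_pDivisibleGroupMap act hp hg).homOfCompatibleFamily a (sub_mem_span_pow hx hcop ha1 ha2)).finrank_cotangent_fixLayer_eq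
    ((isRingActionBT_pDivisibleGroupMap act hp hg).homOfCompatibleFamily_idem a (sub_mem_span_pow hx hcop ha1 ha2)
      (mul_self_sub_mem_span_pow hx hcop ha1 ha2)) h₁ hrank n
  have hN : ((p ^ n : ℕ) : k) = 0 := by rw [Nat.cast_pow, CharP.cast_eq_zero k p, zero_pow hn.ne']
  have h2 := finrank_range_mapCotangent_torsionMap_eq A (pow_ne_zero n hpp.out.ne_zero) hN (act.i (a n))
  exact h1.trans h2

/-- **LAYER `0`: `dim_k I_e(Bw_0)∕I_e² = 0`** (rank `p⁰ = 1`). [cite: Tate1967, §2 (2.1)–(2.2)] -/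
theorem finrank_cotangent_blockLayer_zero :
    letI := (((isRingActionBT_pDivisibleGroupMap act hp hg).homOfCompatibleFamily a (sub_mem_span_pow hx hcop ha1 ha2)).fixBTGroup
      ((isRingActionBT_pDivisibleGroupMap act hp hg).homOfCompatibleFamily_idem a (sub_mem_span_pow hx hcop ha1 ha2)
        (mul_self_sub_mem_span_pow hx hcop ha1 ha2)) h₁ hrank).grpObj 0;
    Module.finrank k (RingHom.ker ((η[(((isRingActionBT_pDivisibleGroupMap act hp hg).homOfCompatibleFamily a
        (sub_mem_span_pow hx hcop ha1 ha2)).fixBTGroup ((isRingActionBT_pDivisibleGroupMap act hp hg).homOfCompatibleFamily_idem a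
        (sub_mem_span_pow hx hcop ha1 ha2) (mul_self_sub_mem_span_pow hx hcop ha1 ha2)) h₁ hrank).G 0] : 𝟙_ (Over (Spec (.of k))) ⟶ _).left.appTop.hom) :
        Ideal (Alg ((((isRingActionBT_pDivisibleGroupMap act hp hg).homOfCompatibleFamily a (sub_mem_span_pow hx hcop ha1 ha2)).fixBTGroup
          ((isRingActionBT_pDivisibleGroupMap act hp hg).homOfCompatibleFamily_idem a (sub_mem_span_pow hx hcop ha1 ha2)
            (mul_self_sub_mem_span_pow hx hcop ha1 ha2)) h₁ hrank).G 0))).Cotangent = 0 := by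
  set Bw := ((isRingActionBT_pDivisibleGroupMap act hp hg).homOfCompatibleFamily a (sub_mem_span_pow hx hcop ha1 ha2)).fixBTGroup
      ((isRingActionBT_pDivisibleGroupMap act hp hg).homOfCompatibleFamily_idem a (sub_mem_span_pow hx hcop ha1 ha2)
        (mul_self_sub_mem_span_pow hx hcop ha1 ha2)) h₁ hrank with hBw
  letI := Bw.grpObj 0
  haveI := Bw.isFinite 0
  apply finrank_cotangent_unitAugIdeal_eq_zero_of_finrank_alg_eq_one
  rw [← hom_finrank_eq_finrank_alg (Bw.G 0) (IsLocalRing.closedPoint k : PrimeSpectrum k), Bw.finrank_eq 0, zero_mul, pow_zero]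

/-- **HEAD — `htan` AND `hdim` OF THE `w`-BLOCK FROM THE LIE SIGNATURE.**  For the `w`-block `Bw := Fix ε_w` of `A[p^∞]` (binders of ★ (O-DOCK)
`PDivisibleGroupBlockDocking` §Block) over a field of characteristic `p`: if for every `n ≥ 1` the endomorphism `act.i (a n)` of the abelian variety has cotangent map of
rank ONE on `𝔪_{A,e}∕𝔪_{A,e}²` (socket (S-T): Kottwitz signature at `w`), then every layer of `Bw` has unit cotangent space of dimension `≤ 1` and layer `1`
has non-zero unit cotangent space — the tokens `htan`, `hdim` of the P6b kit `blockNumerics_of_line` at `B := Bw`, verbatim.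
[cite: Tate1967, §2 (2.1)–(2.2)] [cite: RapoportSmithlingZhang2020Diagonal, §4.1 (p. 17)] -/
theorem htan_hdim_block_of_lieSignature [hpp : Fact p.Prime] [CharP k p]
    (hsig : ∀ n, 0 < n → haveI := act.isMonHom_i (a n);
      Module.finrank k (LinearMap.range (AbelianVariety.cotangentMap A.toAffine.toAbelianVariety
        (InducedCategory.homMk (Grp.ofHom (A := A.X) (B := A.X) (act.i (a n)))))) = 1) :
    (∀ n, letI := (((isRingActionBT_pDivisibleGroupMap act hp hg).homOfCompatibleFamily a (sub_mem_span_pow hx hcop ha1 ha2)).fixBTGroup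
        ((isRingActionBT_pDivisibleGroupMap act hp hg).homOfCompatibleFamily_idem a (sub_mem_span_pow hx hcop ha1 ha2)
          (mul_self_sub_mem_span_pow hx hcop ha1 ha2)) h₁ hrank).grpObj n;
      Module.finrank k (RingHom.ker ((η[(((isRingActionBT_pDivisibleGroupMap act hp hg).homOfCompatibleFamily a
        (sub_mem_span_pow hx hcop ha1 ha2)).fixBTGroup ((isRingActionBT_pDivisibleGroupMap act hp hg).homOfCompatibleFamily_idem a
        (sub_mem_span_pow hx hcop ha1 ha2) (mul_self_sub_mem_span_pow hx hcop ha1 ha2)) h₁ hrank).G n] : 𝟙_ (Over (Spec (.of k))) ⟶ _).left.appTop.hom) :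
        Ideal (Alg ((((isRingActionBT_pDivisibleGroupMap act hp hg).homOfCompatibleFamily a (sub_mem_span_pow hx hcop ha1 ha2)).fixBTGroup
          ((isRingActionBT_pDivisibleGroupMap act hp hg).homOfCompatibleFamily_idem a (sub_mem_span_pow hx hcop ha1 ha2)
            (mul_self_sub_mem_span_pow hx hcop ha1 ha2)) h₁ hrank).G n))).Cotangent ≤ 1) ∧
    (letI := (((isRingActionBT_pDivisibleGroupMap act hp hg).homOfCompatibleFamily a (sub_mem_span_pow hx hcop ha1 ha2)).fixBTGroup
        ((isRingActionBT_pDivisibleGroupMap act hp hg).homOfCompatibleFamily_idem a (sub_mem_span_pow hx hcop ha1 ha2)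
          (mul_self_sub_mem_span_pow hx hcop ha1 ha2)) h₁ hrank).grpObj 1;
      Module.finrank k (RingHom.ker ((η[(((isRingActionBT_pDivisibleGroupMap act hp hg).homOfCompatibleFamily a
        (sub_mem_span_pow hx hcop ha1 ha2)).fixBTGroup ((isRingActionBT_pDivisibleGroupMap act hp hg).homOfCompatibleFamily_idem a
        (sub_mem_span_pow hx hcop ha1 ha2) (mul_self_sub_mem_span_pow hx hcop ha1 ha2)) h₁ hrank).G 1] : 𝟙_ (Over (Spec (.of k))) ⟶ _).left.appTop.hom) :
        Ideal (Alg ((((isRingActionBT_pDivisibleGroupMap act hp hg).homOfCompatibleFamily a (sub_mem_span_pow hx hcop ha1 ha2)).fixBTGroup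
          ((isRingActionBT_pDivisibleGroupMap act hp hg).homOfCompatibleFamily_idem a (sub_mem_span_pow hx hcop ha1 ha2)
            (mul_self_sub_mem_span_pow hx hcop ha1 ha2)) h₁ hrank).G 1))).Cotangent ≠ 0) := by
  refine ⟨fun n => ?_, ?_⟩
  · rcases Nat.eq_zero_or_pos n with rfl | hn
    · rw [finrank_cotangent_blockLayer_zero hp hg act w hx hcop a ha1 ha2 h₁ hrank]
      exact zero_le_one
    · rw [finrank_cotangent_blockLayer_eq_finrank_range_cotangentMap hp hg act w hx hcop a ha1 ha2 h₁ hrank n hn, hsig n hn]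
  · rw [finrank_cotangent_blockLayer_eq_finrank_range_cotangentMap hp hg act w hx hcop a ha1 ha2 h₁ hrank 1 one_pos, hsig 1 one_pos]
    exact one_ne_zero

end Block

end Literature.AlgebraicGeometry.AbelianSchemes

end
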